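import Summits.CriticalPhenomena.CardyFormulaZ2.Theorems.CardySelfRefinementLagHandOffNoIdleAuxGrid
import Summits.CriticalPhenomena.CardyFormulaZ2.Theorems.CardySelfRefinementLagHandOffNoIdleAuxCount
import Summits.CriticalPhenomena.CardyFormulaZ2.Theorems.CardySelfRefinementLagHandOffNoIdleAuxDoublePointsGen
import Summits.CriticalPhenomena.CardyFormulaZ2.Theorems.CardySelfRefinementLagHandOffLimitCurveRegularityNoTrace
import Summits.CriticalPhenomena.CardyFormulaZ2.Theorems.LagHandOff.Negative.DictionaryMerging
import Literature.Probability.Percolation.QuadCrossingDiscreteGluingGarban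
import HarnessLib

/-!
# Limit-curve regularity for line `hitting-tournament` of crux `LagHandOff`
(stmt-CriticalPhenomena-10268): the no-idling conjunct (assembly)

Proves the registered stub `stub_limitCurveRegularity_noIdle` (namespace
`Summit.CriticalPhenomena.CardyFormulaZ2.Cruxes.LagHandOff.HittingTournament`): along positive
meshes `δₙ → 0`, every weak limit `ν` of the interface laws of a `ℤ²`-discretisation family of a
Dobrushin domain `(D; a, b)` is carried by curve classes NO representative of which idles inside
its past range — on every parameter interval `[s, t]` a representative is constant or visits, during
`(s, t)`, a point off `c[0, s]` (Aizenman–Burchard 1999 / Kemppainen–Smirnov 2017, Thm. 1.5).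

Assembly of the landed helpers (parts 4–8 and 7b):

* the first-moment bound for the grid event (`eventually_measure_setOf_le_card_filter_le`): for
  scales `1000ε ≤ R`, a grid `εℤ² ∩ [-Lε, Lε]²` and a threshold `M ≥ 1`, eventually as `δ → 0⁺`,
  `P(at least M bulk grid points g see the interface in altEvent g (2ε) R) ≤ (2L+1)² β / M`,
  `β = 2K(600ε/R)^{1+η}` — Markov's inequality for the number of occurring events
  (`mul_measure_setOf_le_card_filter_le`, part 6) and the four-arm bound for one bulk point
  (`measure_exists_alternates_le`, part 5) fed with the tree's unconditional multi-scale four-arm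
  bound `QuadCrossing.fourArm_bound` (`π₄(m, n) ≤ K (m/n)^{1+η}`, `η > 0`);
* its decay along the dyadic scales `ε_k = R 2^{-k} / 1000`, `L_k = ⌈Rad/ε_k⌉ + 1`,
  `M_k = ⌊R/ε_k⌋ + 1` (`tendsto_gridBound_atTop`): the bound is `≤ C 2^{-kη} → 0`;
* portmanteau (`measure_iInter_eq_zero_of_eventually_le`, part 6): for each `R = 1/(j+1)` the
  open events `G_{j,k}` = "at least `M_k` bulk grid points see the class in the alternation
  event" have `ν (⋂ₖ G_{j,k}) = 0`;
* `ν`-a.s. the class is chordal and traces no boundary arc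
  (`stub_limitCurveRegularity_chordal_noTrace`), so a representative `c` violating the dichotomy
  on `(s, t)` is a curve of `D̄` with ends on `∂D`, no boundary tracing, not constant on `[s, t]`
  and inside its past range during `(s, t)`; by part 7b
  (`exists_forall_le_card_filter_altEvent_of_not_const`) its class lies in `G_{j,k}` for all `k`,
  for every `j` with `1/(j+1) ≤ R₀(c)` — a `ν`-null event.

References: M. Aizenman, A. Burchard, Duke Math. J. 99 (1999), §1.b, §2, App. A; A. Kemppainen,
S. Smirnov, Ann. Probab. 45 (2017), Thm. 1.5; C. Garban, App. B of O. Schramm, S. Smirnov,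
Ann. Probab. 39 (2011), Lemma B.1; P. Billingsley, *Convergence of probability measures* (1999),
Thm. 2.1.
-/

noncomputable section

open MeasureTheory Filter Set Topology Metric
open scoped unitInterval BoundedContinuousFunction ENNReal
open Literature.Probability.Percolation Literature.Probability.LatticeModels
open Literature.Probability.RandomPlanarGeometry Literature.Probability.Percolation.QuadCrossing

namespace Summit.CriticalPhenomena.CardyFormulaZ2.Cruxes.LagHandOff.HittingTournament

/-! ### The first-moment bound for the grid event -/

open scoped Classical in
/-- **First-moment bound for the grid event.** For a `ℤ²`-discretisation family `E` of `D`, a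
four-arm bound `π₄(m, n) ≤ K (m/n)^{1+η}`, scales `1000ε ≤ R`, a grid size `L` and a threshold
`M ≠ 0`: for all small meshes `δ`, the probability that at least `M` grid points `g` of
`εℤ² ∩ [-Lε, Lε]²` at distance `≥ 2R` from `∂D` see the interface class in `altEvent g (2ε) R` is
at most `(2L+1)² · 2K(600ε/R)^{1+η} / M` (Markov's inequality for the number of occurring events,
and the four-arm bound at each bulk grid point). [cite: AizenmanBurchardDuke1999, §2]
[cite: SchrammSmirnov2011, Appendix B (Garban), Lemma B.1] -/
theorem eventually_measure_setOf_le_card_filter_le (D : DobrushinDomain)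
    {E : ℝ → DiscreteDobrushin} (hE : ZdDiscretisationFamily D E) {K η : ℝ} (hK : 0 ≤ K)
    (hη : 0 ≤ η)
    (hbound : ∀ m n : ℕ, 1 ≤ m → m ≤ n →
      (bondPercolation (zdGraph 2) half).real (fourArmTwoClusters m n) ≤
        K * ((m : ℝ) / n) ^ (1 + η))
    {ε R : ℝ} (hε : 0 < ε) (hεR : 1000 * ε ≤ R) (L M : ℕ) (hM : M ≠ 0) :
    ∀ᶠ δ in 𝓝[>] (0 : ℝ),
      bondPercolation (zdGraph 2) half {ω | M ≤ ((sqGrid ε L).filter fun g =>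
          2 * R ≤ infDist g (frontier D.carrier) ∧
            bondInterfaceIn D (E δ) ω ∈ altEvent g (2 * ε) R).card} ≤
        (((2 * L + 1) ^ 2 : ℕ) : ℝ≥0∞) * ENNReal.ofReal (2 * K * (600 * ε / R) ^ (1 + η)) / M := by
  have h3 : ∀ᶠ δ in 𝓝[>] (0 : ℝ), δ ∈ Ioi (0 : ℝ) := self_mem_nhdsWithin
  filter_upwards [measure_exists_alternates_le D hE hK hη hbound hε hεR, h3] with δ hδ hδpos
  set P := bondPercolation (zdGraph 2) half with hP
  have hXm : Measurable (bondInterfaceIn D (E δ)) :=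
    Theorems.LagHandOff.Negative.measurable_bondInterfaceIn_family hE hδpos
  set β : ℝ≥0∞ := ENNReal.ofReal (2 * K * (600 * ε / R) ^ (1 + η)) with hβ
  set A : ℂ → Set (BondConfig (Site 2)) := fun g =>
    {ω | 2 * R ≤ infDist g (frontier D.carrier) ∧ bondInterfaceIn D (E δ) ω ∈ altEvent g (2 * ε) R}
    with hA
  have hAempty : ∀ g, ¬ 2 * R ≤ infDist g (frontier D.carrier) → A g = ∅ := fun g hg => by
    ext ω; exact ⟨fun h => hg h.1, fun h => h.elim⟩
  have hAm : ∀ g ∈ sqGrid ε L, MeasurableSet (A g) := by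
    intro g _
    by_cases hg : 2 * R ≤ infDist g (frontier D.carrier)
    · have : A g = bondInterfaceIn D (E δ) ⁻¹' altEvent g (2 * ε) R := by
        ext ω; exact ⟨fun h => h.2, fun h => ⟨hg, h⟩⟩
      rw [this]
      exact hXm (isOpen_altEvent g _ _).measurableSet
    · rw [hAempty g hg]
      exact MeasurableSet.empty
  have hAle : ∀ g ∈ sqGrid ε L, P (A g) ≤ β := by
    intro g _
    by_cases hg : 2 * R ≤ infDist g (frontier D.carrier)
    · refine (measure_mono fun ω hω => ?_).trans (hδ g hg)
      exact mem_altEvent_iff.1 hω.2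
    · rw [hAempty g hg, measure_empty]
      exact bot_le
  have hmarkov := mul_measure_setOf_le_card_filter_le P (sqGrid ε L) A hAm M
  have hsum : ∑ g ∈ sqGrid ε L, P (A g) ≤ (((2 * L + 1) ^ 2 : ℕ) : ℝ≥0∞) * β :=
    calc ∑ g ∈ sqGrid ε L, P (A g) ≤ ∑ g ∈ sqGrid ε L, β := Finset.sum_le_sum hAle
      _ = ((sqGrid ε L).card : ℝ≥0∞) * β := by rw [Finset.sum_const, nsmul_eq_mul]
      _ ≤ (((2 * L + 1) ^ 2 : ℕ) : ℝ≥0∞) * β := by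
          gcongr
          exact_mod_cast card_sqGrid_le ε L
  have hMne : (M : ℝ≥0∞) ≠ 0 := Nat.cast_ne_zero.2 hM
  calc P {ω | M ≤ ((sqGrid ε L).filter fun g =>
          2 * R ≤ infDist g (frontier D.carrier) ∧
            bondInterfaceIn D (E δ) ω ∈ altEvent g (2 * ε) R).card}
      = P {ω | M ≤ ((sqGrid ε L).filter fun g => ω ∈ A g).card} := rfl
    _ ≤ (∑ g ∈ sqGrid ε L, P (A g)) / M := by
        rw [ENNReal.le_div_iff_mul_le (Or.inl hMne) (Or.inl (ENNReal.natCast_ne_top M)), mul_comm]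
        exact hmarkov
    _ ≤ (((2 * L + 1) ^ 2 : ℕ) : ℝ≥0∞) * β / M := ENNReal.div_le_div_right hsum _

/-! ### Decay of the bound along dyadic scales -/

/-- **The first-moment bound decays along the dyadic scales** `ε_k = R 2^{-k}/1000`,
`L_k = ⌈Rad/ε_k⌉ + 1`, `M_k = ⌊R/ε_k⌋ + 1`: with `x = 2^{-k}`, `2L_k + 1 ≤ (2000 Rad/R + 5)/x`,
`(600ε_k/R)^{1+η} ≤ x^{1+η}`, `1/M_k ≤ x/1000`, so the bound is `≤ C x^η → 0` (`η > 0`).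
[cite: AizenmanBurchardDuke1999, §2] -/
theorem tendsto_gridBound_atTop {K η R Rad : ℝ} (hK : 0 ≤ K) (hη : 0 < η) (hR : 0 < R)
    (hRad : 0 ≤ Rad) {ε : ℕ → ℝ} {L M : ℕ → ℕ} (hε : ∀ k, ε k = R * (1 / 2) ^ k / 1000)
    (hL : ∀ k, L k = ⌈Rad / ε k⌉₊ + 1) (hM : ∀ k, M k = ⌊R / ε k⌋₊ + 1) :
    Tendsto (fun k => (((2 * L k + 1) ^ 2 : ℕ) : ℝ≥0∞) *
      ENNReal.ofReal (2 * K * (600 * ε k / R) ^ (1 + η)) / (M k : ℝ≥0∞)) atTop (𝓝 0) := by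
  set x : ℕ → ℝ := fun k => (1 / 2 : ℝ) ^ k with hx
  have hx0 : ∀ k, 0 < x k := fun k => by simp only [hx]; positivity
  have hx1 : ∀ k, x k ≤ 1 := fun k => by
    simp only [hx]; exact pow_le_one₀ (by norm_num) (by norm_num)
  have hRne : R ≠ 0 := hR.ne'
  set A : ℝ := 2000 * Rad / R + 5 with hA
  set C : ℝ := 2 * K * A ^ 2 / 1000 with hC
  ---------------------------------------------------------------- the real bound
  have hreal : ∀ k,
      (((2 * L k + 1) ^ 2 : ℕ) : ℝ) * (2 * K * (600 * ε k / R) ^ (1 + η)) / (M k : ℝ) ≤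
        C * x k ^ η := by
    intro k
    have hxne : x k ≠ 0 := (hx0 k).ne'
    have hεk : ε k = R * x k / 1000 := by simp only [hε k, hx]
    have hεpos : 0 < ε k := by rw [hεk]; exact div_pos (mul_pos hR (hx0 k)) (by norm_num)
    -- `2L + 1 ≤ A / x`
    have ha : ((2 * L k + 1 : ℕ) : ℝ) ≤ A / x k := by
      have h1 : (⌈Rad / ε k⌉₊ : ℝ) < Rad / ε k + 1 := Nat.ceil_lt_add_one (div_nonneg hRad hεpos.le)
      have h2 : Rad / ε k = 1000 * Rad / (R * x k) := by
        rw [hεk, div_div_eq_mul_div]; ring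
      have h3 : (5 : ℝ) ≤ 5 / x k := by
        rw [le_div_iff₀ (hx0 k)]; nlinarith [hx1 k, hx0 k]
      have h4 : A / x k = 2 * (1000 * Rad / (R * x k)) + 5 / x k := by
        rw [hA, add_div, div_div]; ring
      rw [h4, ← h2, hL k]
      push_cast
      linarith
    -- `(600ε/R)^{1+η} ≤ x^η x`
    have hy : (600 * ε k / R) ^ (1 + η) ≤ x k ^ η * x k := by
      have h1 : 600 * ε k / R = 3 / 5 * x k := by
        calc 600 * ε k / R = (R / R) * (3 / 5 * x k) := by rw [hεk]; ring
          _ = 3 / 5 * x k := by rw [div_self hRne, one_mul]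
      rw [h1]
      calc (3 / 5 * x k) ^ (1 + η) ≤ (x k) ^ (1 + η) :=
            Real.rpow_le_rpow (by linarith [hx0 k]) (by linarith [hx0 k]) (by linarith)
        _ = x k ^ η * x k := by rw [add_comm, Real.rpow_add_one hxne]
    have hy0 : 0 ≤ (600 * ε k / R) ^ (1 + η) :=
      Real.rpow_nonneg (div_nonneg (by linarith) hR.le) _
    -- `1/M ≤ x/1000`
    have hm : 1 / (M k : ℝ) ≤ x k / 1000 := by
      have h1 : R / ε k < (⌊R / ε k⌋₊ : ℝ) + 1 := Nat.lt_floor_add_one _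
      have h2 : R / ε k = 1000 / x k := by
        rw [hεk, div_div_eq_mul_div, mul_div_mul_left _ _ hRne]
      rw [hM k, Nat.cast_add, Nat.cast_one, div_le_div_iff₀ (by positivity) (by norm_num)]
      rw [h2] at h1 ⊢
      rw [div_lt_iff₀ (hx0 k)] at h1
      nlinarith [h1, hx0 k]
    have hm0 : (0 : ℝ) ≤ 1 / (M k : ℝ) := by positivity
    -- combine
    have hsq : ((2 * L k + 1 : ℕ) : ℝ) ^ 2 ≤ (A / x k) ^ 2 :=
      pow_le_pow_left₀ (Nat.cast_nonneg _) ha 2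
    have hprod : ((2 * L k + 1 : ℕ) : ℝ) ^ 2 * (600 * ε k / R) ^ (1 + η) * (1 / (M k : ℝ)) ≤
        (A / x k) ^ 2 * (x k ^ η * x k) * (x k / 1000) :=
      mul_le_mul (mul_le_mul hsq hy hy0 (sq_nonneg _)) hm hm0
        (mul_nonneg (sq_nonneg _) (hy0.trans hy))
    have hKA : 0 ≤ 2 * K := by linarith
    calc (((2 * L k + 1) ^ 2 : ℕ) : ℝ) * (2 * K * (600 * ε k / R) ^ (1 + η)) / (M k : ℝ)
        = 2 * K * (((2 * L k + 1 : ℕ) : ℝ) ^ 2 * (600 * ε k / R) ^ (1 + η) * (1 / (M k : ℝ))) := by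
          push_cast; ring
      _ ≤ 2 * K * ((A / x k) ^ 2 * (x k ^ η * x k) * (x k / 1000)) :=
          mul_le_mul_of_nonneg_left hprod hKA
      _ = C * x k ^ η := by
          rw [hC]; field_simp
  ---------------------------------------------------------------- the limit
  have hr1 : (1 / 2 : ℝ) ^ η < 1 := Real.rpow_lt_one (by norm_num) (by norm_num) hη
  have hr0 : 0 ≤ (1 / 2 : ℝ) ^ η := Real.rpow_nonneg (by norm_num) _
  have hxη : ∀ k, x k ^ η = ((1 / 2 : ℝ) ^ η) ^ k := fun k => by
    simp only [hx]
    rw [← Real.rpow_natCast_mul (by norm_num : (0 : ℝ) ≤ 1 / 2), mul_comm,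
      Real.rpow_mul_natCast (by norm_num : (0 : ℝ) ≤ 1 / 2)]
  have hlim : Tendsto (fun k => ENNReal.ofReal (C * x k ^ η)) atTop (𝓝 0) := by
    rw [← ENNReal.ofReal_zero]
    refine ENNReal.tendsto_ofReal ?_
    have h := (tendsto_pow_atTop_nhds_zero_of_lt_one hr0 hr1).const_mul C
    rw [mul_zero] at h
    exact h.congr fun k => by rw [hxη]
  refine tendsto_of_tendsto_of_tendsto_of_le_of_le tendsto_const_nhds hlim (fun k => bot_le)
    fun k => ?_
  have hM0 : (0 : ℝ) < (M k : ℝ) := by rw [hM k]; positivity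
  have hnn : (0 : ℝ) ≤ (((2 * L k + 1) ^ 2 : ℕ) : ℝ) := Nat.cast_nonneg _
  calc (((2 * L k + 1) ^ 2 : ℕ) : ℝ≥0∞) * ENNReal.ofReal (2 * K * (600 * ε k / R) ^ (1 + η)) /
        (M k : ℝ≥0∞)
      = ENNReal.ofReal ((((2 * L k + 1) ^ 2 : ℕ) : ℝ) * (2 * K * (600 * ε k / R) ^ (1 + η)) /
          (M k : ℝ)) := by
        rw [ENNReal.ofReal_div_of_pos hM0, ENNReal.ofReal_mul hnn, ENNReal.ofReal_natCast,
          ENNReal.ofReal_natCast]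
    _ ≤ ENNReal.ofReal (C * x k ^ η) := ENNReal.ofReal_le_ofReal (hreal k)

/-! ### The registered stub: a.s. no idling of the limit interface -/

open scoped Classical in
/-- **Conjunct (3) of `stub_limitCurveRegularity` — registered stub
`stub_limitCurveRegularity_noIdle`.** Along positive meshes `δₙ → 0`, every weak limit `ν` of the
interface laws of a `ℤ²`-discretisation family of `(D; a, b)` is carried by curve classes no
representative of which idles inside its past range: on every parameter interval `[s, t]` a
representative is constant, or during `(s, t)` it visits a point off `c[0, s]`. See the module
docstring for the assembly. [cite: KemppainenSmirnov2017, Thm. 1.5]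
[cite: AizenmanBurchardDuke1999, §2] -/
theorem stub_limitCurveRegularity_noIdle :
    ∀ (D : DobrushinDomain) (E : ℝ → DiscreteDobrushin), ZdDiscretisationFamily D E →
      ∀ δs : ℕ → ℝ, (∀ n, 0 < δs n) → Tendsto δs atTop (𝓝 0) →
        ∀ (ν : Measure (CurveClass ℂ)) [IsProbabilityMeasure ν],
          (∀ f : CurveClass ℂ →ᵇ ℝ,
            Tendsto (fun n => ∫ ω, f (bondInterfaceIn D (E (δs n)) ω)
              ∂(bondPercolation (zdGraph 2) half)) atTop (𝓝 (∫ γ, f γ ∂ν))) →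
          ∀ᵐ γ ∂ν, ∀ c : Curve ℂ, CurveClass.mk c = γ → ∀ s t : I, s < t →
              (∀ u ∈ Set.Icc s t, c u = c s) ∨ ∃ u ∈ Set.Ioo s t, c u ∉ c '' Set.Icc 0 s := by
  intro D E hE δs hpos hlim ν hν hconv
  classical
  have hδs : Tendsto δs atTop (𝓝[>] 0) :=
    tendsto_nhdsWithin_iff.2 ⟨hlim, Eventually.of_forall hpos⟩
  have hXm : ∀ n, Measurable (bondInterfaceIn D (E (δs n))) := fun n =>
    Theorems.LagHandOff.Negative.measurable_bondInterfaceIn_family hE (hpos n)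
  obtain ⟨K, η, hK, hη, hbound⟩ := QuadCrossing.fourArm_bound
  obtain ⟨Rad, hRadsub⟩ := D.isBounded.closure.subset_closedBall (0 : ℂ)
  set Rad₀ : ℝ := max Rad 0 with hRad₀
  have hRad₀nn : 0 ≤ Rad₀ := le_max_right _ _
  ---------------------------------------------------------------- the scales
  set R : ℕ → ℝ := fun j => 1 / ((j : ℝ) + 1) with hRdef
  have hRpos : ∀ j, 0 < R j := fun j => by simp only [hRdef]; positivity
  set ε : ℕ → ℕ → ℝ := fun j k => R j * (1 / 2) ^ k / 1000 with hεdef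
  have hεpos : ∀ j k, 0 < ε j k := fun j k => by
    simp only [hεdef]; exact div_pos (mul_pos (hRpos j) (by positivity)) (by norm_num)
  have hεR : ∀ j k, 1000 * ε j k ≤ R j := fun j k => by
    have h1 : (1 / 2 : ℝ) ^ k ≤ 1 := pow_le_one₀ (by norm_num) (by norm_num)
    simp only [hεdef]
    rw [show 1000 * (R j * (1 / 2 : ℝ) ^ k / 1000) = R j * (1 / 2) ^ k by ring]
    exact mul_le_of_le_one_right (hRpos j).le h1
  set L : ℕ → ℕ → ℕ := fun j k => ⌈Rad₀ / ε j k⌉₊ + 1 with hLdef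
  have hL : ∀ j k, Rad₀ / ε j k + 1 ≤ (L j k : ℝ) := fun j k => by
    simp only [hLdef]; push_cast; linarith [Nat.le_ceil (Rad₀ / ε j k)]
  set M : ℕ → ℕ → ℕ := fun j k => ⌊R j / ε j k⌋₊ + 1 with hMdef
  ---------------------------------------------------------------- the null events
  set G : ℕ → ℕ → Set (CurveClass ℂ) := fun j k => {γ | M j k ≤ ((sqGrid (ε j k) (L j k)).filter
      fun g => 2 * R j ≤ infDist g (frontier D.carrier) ∧ γ ∈ altEvent g (2 * ε j k) (R j)).card}
    with hGdef
  have hGopen : ∀ j k, IsOpen (G j k) := fun j k =>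
    isOpen_setOf_le_card_filter (sqGrid (ε j k) (L j k))
      (fun g => {γ : CurveClass ℂ | 2 * R j ≤ infDist g (frontier D.carrier) ∧
        γ ∈ altEvent g (2 * ε j k) (R j)})
      (fun g _ => isOpen_const.and (isOpen_altEvent g _ _)) (M j k)
  have hnull : ∀ j, ν (⋂ k, G j k) = 0 := by
    intro j
    refine measure_iInter_eq_zero_of_eventually_le (X := fun n => bondInterfaceIn D (E (δs n)))
      (P := bondPercolation (zdGraph 2) half) hXm hconv (hGopen j)
      (b := fun k => (((2 * L j k + 1) ^ 2 : ℕ) : ℝ≥0∞) *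
        ENNReal.ofReal (2 * K * (600 * ε j k / R j) ^ (1 + η)) / (M j k : ℝ≥0∞)) ?_ ?_
    · intro k
      have hev := hδs.eventually (eventually_measure_setOf_le_card_filter_le D hE hK.le hη.le
        hbound (hεpos j k) (hεR j k) (L j k) (M j k) (Nat.succ_ne_zero _))
      filter_upwards [hev] with n hn
      exact hn
    · exact tendsto_gridBound_atTop hK.le hη (hRpos j) hRad₀nn (fun _ => rfl) (fun _ => rfl)
        (fun _ => rfl)
  have hae : ∀ᵐ γ ∂ν, ∀ j, ∃ k, γ ∉ G j k := by
    rw [ae_all_iff]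
    intro j
    have h := (measure_eq_zero_iff_ae_notMem (μ := ν)).1 (hnull j)
    filter_upwards [h] with γ hγ
    simpa only [mem_iInter, not_forall] using hγ
  ---------------------------------------------------------------- conclusion
  filter_upwards [stub_limitCurveRegularity_chordal_noTrace D E hE δs hpos hlim ν hconv, hae]
    with γ hreg hG c hc s t hst
  obtain ⟨⟨hsrc, htgt, hrange⟩, hnt⟩ := hreg
  by_contra hnot
  obtain ⟨hnc, hpast⟩ := not_or.1 hnot
  push Not at hpast
  subst hc
  have hcl : ∀ u, c u ∈ closure D.carrier := fun u =>
    hrange (by rw [CurveClass.range_mk]; exact Curve.mem_range.2 ⟨u, rfl⟩)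
  have h0 : c 0 ∈ frontier D.carrier := by
    rw [show c 0 = D.pt 0 from hsrc]; exact D.pt_mem_frontier 0
  have h1 : c 1 ∈ frontier D.carrier := by
    rw [show c 1 = D.pt 1 from htgt]; exact D.pt_mem_frontier 1
  have hRad' : ∀ u, ‖c u‖ ≤ Rad₀ := fun u => by
    have := hRadsub (hcl u)
    rw [mem_closedBall, dist_zero_right] at this
    exact this.trans (le_max_left _ _)
  obtain ⟨R₀, hR₀, hdp⟩ := exists_forall_le_card_filter_altEvent_of_not_const D hcl h0 h1
    (hnt c rfl) hst hnc hpast hRad'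
  obtain ⟨j, hj⟩ := exists_nat_one_div_lt hR₀
  obtain ⟨k, hk⟩ := hG j
  exact hk (hdp (R j) (hRpos j) hj.le (ε j k) (hεpos j k) (hεR j k) (L j k) (hL j k))

end Summit.CriticalPhenomena.CardyFormulaZ2.Cruxes.LagHandOff.HittingTournament

end
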